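/-
Copyright (c) 2026 the pub-hodgecm-mathlib formalisation cell (harness21).  Prover seat hodgecm-mathlib-K2E5-p16 (g5): Track B «K2-LIT»,
hLiu418 = stmt-HodgeConjecture-24832, ROAD Φ organ Φ6b-5 (lattice Fourier series of `Ξ` over the places), file (6b): THE LATTICE COUNT
`summable_lattice_prod_majorant` (head (H2) of the binding deal K2E5-plan (g6) 2026-09-04 08:40:55Z); 2026-09-04.
-/
import Summits.HodgeConjecture.HodgeConjecture.Theorems.K2LiuHermTwoEtaConvergence      -- ★ p857940: trace∕det inequalities in the chart
import Mathlib.Algebra.Module.ZLattice.Summable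
import HarnessLib

/-!
# Crux `HLiu418`, ROAD Φ, organ Φ6b-5 — file (6b): the lattice count `Σ_{λ ∈ Λ⁺} ∏_σ e^{−2π Re tr(λ_σ g_σ)} (1 + tr λ_σ)^N (1 + det(λ_σ)^{−N′}) < ∞`

Cell `hodgecm-mathlib`, crux item hLiu418 = `stmt-HodgeConjecture-24832`, route of record `HCCMUnconditional`; squad K2, LEAD F0P6-plan (g13),
co-dealer K2E5-plan (g6) (binding deal Φ6b-5, head (H2) with the arithmetic binder `hdet`), prover K2E5-p16 (g5).  THEOREMS ONLY (no `def`,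
no instance, no notation, no named-fact hypothesis, no `sorry`); lane `--supports stmt-HodgeConjecture-24832 --as helper`.

THE COUNT (`summable_lattice_prod_majorant`).  `S` a finite type (the real places of `L⁺`), `g : S → Matrix (Fin 2) (Fin 2) ℂ` positive definite,
`Λ` a DISCRETE `ℤ`-submodule of `V := S → (Fin 2 → Fin 2 → ℂ)` (plain Pi type: sup norm; matrices enter through `Matrix.of`), and the
arithmetic binder `hdet : ∃ c > 0, ∀ l ∈ Λ, (∀ σ, l_σ > 0) → c ≤ ∏_σ det l_σ` (norms of non-zero elements of a fractional ideal are bounded below —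
discharged by Φ9's assembler).  Then for all real `N, N′ ≥ 0` the three-factor majorant of ★ `norm_xiShift_le₂` ∕ `norm_xiEtaRhs_le₂` is summable
over the totally positive lattice points `ι := {l : Λ // ∀ σ, (Matrix.of (l σ)).PosDef}`:
  `Summable (fun i : ι => ∏_σ e^{−2π Re tr(l_σ g_σ)} (1 + tr l_σ)^N (1 + det(l_σ)^{−N′}))`.
PROOF (elementary).  On the cone: entries of `l_σ` are `≤ tr l_σ`, so `‖l‖ ≤ Σ_σ tr l_σ =: T` (`norm_le_sum_trace`); `Re tr(l_σ g_σ) ≥ c·tr l_σ`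
with `c = min_σ det g_σ ∕ tr g_σ > 0` (★ `trace_mul_lower_bound`); `det l_σ ≤ (tr l_σ)²` (★ `det_le_trace_sq`) and `hdet` give
`det(l_σ)⁻¹ ≤ c₀⁻¹ (1 + T)^{2|S|}`; hence the summand is `≤ C_k e^{−2πcT}(1 + T)^{Q} ≤ C′_k (1 + ‖l‖)^{−k}` for every `k ≥ 0`
(★ `rpow_le_const_mul_exp`), and `Σ_{l ∈ Λ} (1 + ‖l‖)^{−k} < ∞` for `k > rank Λ` is Mathlib's ★ `ZLattice.summable_norm_rpow` (needs only
`[DiscreteTopology Λ]`, no full rank).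
HONEST LABEL.  Count-neutral helper of the K2_Liu road; it pays no socket by itself: `HC_CM` is proved only modulo the 7 printed citations
(2 remaining named inputs: hLiu418 = `stmt-HodgeConjecture-24832`, h413 = `stmt-HodgeConjecture-24833`) until rung 0 closes.
-/

set_option autoImplicit false
-- the mandated namespace repeats the single-problem summit's segment (`HodgeConjecture.HodgeConjecture`)
set_option linter.dupNamespace false

noncomputable section

open Complex Set
open scoped ComplexOrder ComplexConjugate

namespace Summit.HodgeConjecture.HodgeConjecture.Cruxes.HLiu418.K2LiuHermTwoLatticeProdMajorant

open Summit.HodgeConjecture.HodgeConjecture.Cruxes.HLiu418.K2LiuHermTwoGammaDefs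
open Summit.HodgeConjecture.HodgeConjecture.Cruxes.HLiu418.K2LiuHermTwoEtaConvergence

/-! ## Positive definite `2 × 2` matrices in raw coordinates `x : Fin 2 → Fin 2 → ℂ` -/

/-- The chart of a positive definite `Matrix.of x`: `Matrix.of x = hermTwo ((x 0 0).re, x 0 1, (x 1 1).re)` with `0 < (x 0 0).re` and
`|x 0 1|² < (x 0 0).re · (x 1 1).re`. -/
theorem chart_of_posDef {x : Fin 2 → Fin 2 → ℂ} (hx : (Matrix.of x).PosDef) :
    hermTwo ((x 0 0).re, x 0 1, (x 1 1).re) = Matrix.of x ∧ 0 < (x 0 0).re ∧ normSq (x 0 1) < (x 0 0).re * (x 1 1).re := by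
  have h := hermTwo_eq_of_isHermitian hx.1
  simp only [Matrix.of_apply] at h
  have hc := (posDef_hermTwo_iff ((x 0 0).re, x 0 1, (x 1 1).re)).mp (by rw [h]; exact hx)
  exact ⟨h, hc.1, hc.2⟩

/-- Trace positivity in raw coordinates. -/
theorem trace_re_pos {x : Fin 2 → Fin 2 → ℂ} (hx : (Matrix.of x).PosDef) : 0 < (x 0 0).re + (x 1 1).re := by
  obtain ⟨-, ha, hz⟩ := chart_of_posDef hx
  have hb : 0 < (x 1 1).re := snd_pos_of_cone ha hz
  linarith

/-- Determinant positivity in raw coordinates. -/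
theorem det_re_pos {x : Fin 2 → Fin 2 → ℂ} (hx : (Matrix.of x).PosDef) : 0 < (x 0 0).re * (x 1 1).re - normSq (x 0 1) := by
  obtain ⟨-, -, hz⟩ := chart_of_posDef hx
  linarith

/-- ENTRIES ARE BOUNDED BY THE TRACE: for positive definite `Matrix.of x`, `|x i j| ≤ (x 0 0).re + (x 1 1).re`. -/
theorem norm_apply_le_trace {x : Fin 2 → Fin 2 → ℂ} (hx : (Matrix.of x).PosDef) (i j : Fin 2) :
    ‖x i j‖ ≤ (x 0 0).re + (x 1 1).re := by
  obtain ⟨h, ha, hz⟩ := chart_of_posDef hx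
  have hb : 0 < (x 1 1).re := snd_pos_of_cone ha hz
  have e00 : x 0 0 = (((x 0 0).re : ℝ) : ℂ) := by simpa [hermTwo] using (congrFun (congrFun h 0) 0).symm
  have e11 : x 1 1 = (((x 1 1).re : ℝ) : ℂ) := by simpa [hermTwo] using (congrFun (congrFun h 1) 1).symm
  have e10 : x 1 0 = conj (x 0 1) := by simpa [hermTwo] using (congrFun (congrFun h 1) 0).symm
  have b01 : ‖x 0 1‖ ≤ (x 0 0).re + (x 1 1).re := by
    have hs0 : 0 ≤ ‖x 0 1‖ := norm_nonneg _
    have hs2 : ‖x 0 1‖ ^ 2 < (x 0 0).re * (x 1 1).re := by rw [Complex.sq_norm]; exact hz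
    nlinarith [sq_nonneg ((x 0 0).re - (x 1 1).re)]
  have b00 : ‖x 0 0‖ ≤ (x 0 0).re + (x 1 1).re := by
    have hn : ‖x 0 0‖ = (x 0 0).re := by
      rw [show ‖x 0 0‖ = ‖(((x 0 0).re : ℝ) : ℂ)‖ by rw [← e00], Complex.norm_real, Real.norm_eq_abs, abs_of_pos ha]
    rw [hn]
    linarith
  have b11 : ‖x 1 1‖ ≤ (x 0 0).re + (x 1 1).re := by
    have hn : ‖x 1 1‖ = (x 1 1).re := by
      rw [show ‖x 1 1‖ = ‖(((x 1 1).re : ℝ) : ℂ)‖ by rw [← e11], Complex.norm_real, Real.norm_eq_abs, abs_of_pos hb]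
    rw [hn]
    linarith
  have b10 : ‖x 1 0‖ ≤ (x 0 0).re + (x 1 1).re := by
    rw [e10, Complex.norm_conj]
    exact b01
  fin_cases i <;> fin_cases j
  · exact b00
  · exact b01
  · exact b10
  · exact b11

/-- THE SUP NORM OF A TOTALLY POSITIVE VECTOR IS AT MOST THE TOTAL TRACE: `‖l‖ ≤ Σ_σ tr l_σ`. -/
theorem norm_le_sum_trace {S : Type*} [Fintype S] (l : S → Fin 2 → Fin 2 → ℂ) (hl : ∀ σ, (Matrix.of (l σ)).PosDef) :
    ‖l‖ ≤ ∑ σ, ((l σ 0 0).re + (l σ 1 1).re) := by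
  have hT0 : 0 ≤ ∑ σ, ((l σ 0 0).re + (l σ 1 1).re) := Finset.sum_nonneg fun σ _ => (trace_re_pos (hl σ)).le
  refine (pi_norm_le_iff_of_nonneg hT0).mpr fun σ => (pi_norm_le_iff_of_nonneg hT0).mpr fun i =>
    (pi_norm_le_iff_of_nonneg hT0).mpr fun j => (norm_apply_le_trace (hl σ) i j).trans ?_
  exact Finset.single_le_sum (f := fun τ => (l τ 0 0).re + (l τ 1 1).re) (fun τ _ => (trace_re_pos (hl τ)).le) (Finset.mem_univ σ)

/-- THE TRACE LOWER BOUND, uniformly over the places: there is `c > 0` with `c · tr x ≤ Re tr(x g_σ)` for every `σ` and every positive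
definite `Matrix.of x` (`c = min_σ det g_σ ∕ tr g_σ`; ★ `trace_mul_lower_bound`). -/
theorem exists_trace_mul_lower {S : Type*} [Fintype S] {g : S → Matrix (Fin 2) (Fin 2) ℂ} (hg : ∀ σ, (g σ).PosDef) :
    ∃ c : ℝ, 0 < c ∧ ∀ (σ : S) (x : Fin 2 → Fin 2 → ℂ), (Matrix.of x).PosDef →
      c * ((x 0 0).re + (x 1 1).re) ≤ ((Matrix.of x * g σ).trace).re := by
  -- per place
  have hper : ∀ σ : S, ∀ x : Fin 2 → Fin 2 → ℂ, (Matrix.of x).PosDef →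
      ((g σ 0 0).re * (g σ 1 1).re - normSq (g σ 0 1)) / ((g σ 0 0).re + (g σ 1 1).re) * ((x 0 0).re + (x 1 1).re) ≤
        ((Matrix.of x * g σ).trace).re := by
    intro σ x hx
    obtain ⟨hxc, ha, hz⟩ := chart_of_posDef hx
    have hgc : hermTwo ((g σ 0 0).re, g σ 0 1, (g σ 1 1).re) = g σ := hermTwo_eq_of_isHermitian (hg σ).1
    have hgd := (posDef_hermTwo_iff ((g σ 0 0).re, g σ 0 1, (g σ 1 1).re)).mp (by rw [hgc]; exact hg σ)
    have hq : 0 < (g σ 1 1).re := snd_pos_of_cone hgd.1 hgd.2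
    have htr : 0 < (g σ 0 0).re + (g σ 1 1).re := by linarith [hgd.1]
    have h := trace_mul_lower_bound ha hz hgd.1 hgd.2
    have htr_eq : ((Matrix.of x * g σ).trace).re =
        (x 0 0).re * (g σ 0 0).re + (x 1 1).re * (g σ 1 1).re + 2 * (x 0 1 * conj (g σ 0 1)).re := by
      conv_lhs => rw [← hxc, ← hgc]
      rw [trace_hermTwo_mul_hermTwo, ofReal_re]
    rw [htr_eq]
    simp only at h
    rw [div_mul_eq_mul_div, div_le_iff₀ htr]
    linarith
  rcases isEmpty_or_nonempty S with hS | hS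
  · exact ⟨1, one_pos, fun σ => (IsEmpty.false σ).elim⟩
  · obtain ⟨σ₀, -, hmin⟩ := Finset.exists_min_image Finset.univ
      (fun σ : S => ((g σ 0 0).re * (g σ 1 1).re - normSq (g σ 0 1)) / ((g σ 0 0).re + (g σ 1 1).re)) Finset.univ_nonempty
    have hpos : ∀ σ : S, 0 < ((g σ 0 0).re * (g σ 1 1).re - normSq (g σ 0 1)) / ((g σ 0 0).re + (g σ 1 1).re) := by
      intro σ
      have hgc : hermTwo ((g σ 0 0).re, g σ 0 1, (g σ 1 1).re) = g σ := hermTwo_eq_of_isHermitian (hg σ).1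
      have hgd := (posDef_hermTwo_iff ((g σ 0 0).re, g σ 0 1, (g σ 1 1).re)).mp (by rw [hgc]; exact hg σ)
      have hq : 0 < (g σ 1 1).re := snd_pos_of_cone hgd.1 hgd.2
      exact div_pos (by simp only at hgd; linarith [hgd.2]) (by linarith [hgd.1])
    refine ⟨_, hpos σ₀, fun σ x hx => le_trans ?_ (hper σ x hx)⟩
    exact mul_le_mul_of_nonneg_right (hmin σ (Finset.mem_univ σ)) (trace_re_pos hx).le

/-! ## The pointwise majorant -/

/-- `det(l_σ)⁻¹ ≤ c₀⁻¹ (1 + T)^{2|S|}` on a totally positive vector with `∏_σ det l_σ ≥ c₀`, `T = Σ_σ tr l_σ`. -/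
theorem inv_det_le {S : Type*} [Fintype S] (l : S → Fin 2 → Fin 2 → ℂ) (hl : ∀ σ, (Matrix.of (l σ)).PosDef) {c₀ : ℝ} (hc₀ : 0 < c₀)
    (hdet : c₀ ≤ ∏ σ, ((l σ 0 0).re * (l σ 1 1).re - normSq (l σ 0 1))) (σ : S) :
    ((l σ 0 0).re * (l σ 1 1).re - normSq (l σ 0 1))⁻¹ ≤
      c₀⁻¹ * (1 + ∑ τ, ((l τ 0 0).re + (l τ 1 1).re)) ^ (2 * Fintype.card S) := by
  classical
  set T : ℝ := ∑ τ, ((l τ 0 0).re + (l τ 1 1).re) with hT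
  have hT0 : 0 ≤ T := Finset.sum_nonneg fun τ _ => (trace_re_pos (hl τ)).le
  have hB1 : 1 ≤ 1 + T := by linarith
  have hDσ : 0 < (l σ 0 0).re * (l σ 1 1).re - normSq (l σ 0 1) := det_re_pos (hl σ)
  -- each determinant is `≤ (1 + T)²`
  have hDle : ∀ τ : S, (l τ 0 0).re * (l τ 1 1).re - normSq (l τ 0 1) ≤ (1 + T) ^ 2 := by
    intro τ
    have h1 := det_le_trace_sq (l τ 0 0).re (l τ 1 1).re (l τ 0 1)
    have h2 : (l τ 0 0).re + (l τ 1 1).re ≤ T :=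
      Finset.single_le_sum (f := fun τ => (l τ 0 0).re + (l τ 1 1).re) (fun τ _ => (trace_re_pos (hl τ)).le) (Finset.mem_univ τ)
    have h3 : 0 ≤ (l τ 0 0).re + (l τ 1 1).re := (trace_re_pos (hl τ)).le
    nlinarith
  -- `c₀ ≤ det l_σ · ∏_{τ ≠ σ} det l_τ ≤ det l_σ · (1 + T)^{2|S|}`
  have hsplit := Finset.prod_erase_mul Finset.univ (fun τ => (l τ 0 0).re * (l τ 1 1).re - normSq (l τ 0 1)) (Finset.mem_univ σ)
  have hrest : ∏ τ ∈ Finset.univ.erase σ, ((l τ 0 0).re * (l τ 1 1).re - normSq (l τ 0 1)) ≤ (1 + T) ^ (2 * Fintype.card S) := by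
    calc ∏ τ ∈ Finset.univ.erase σ, ((l τ 0 0).re * (l τ 1 1).re - normSq (l τ 0 1))
        ≤ ∏ τ ∈ Finset.univ.erase σ, (1 + T) ^ 2 := Finset.prod_le_prod (fun τ _ => (det_re_pos (hl τ)).le) fun τ _ => hDle τ
      _ = ((1 + T) ^ 2) ^ (Finset.univ.erase σ).card := Finset.prod_const _
      _ ≤ ((1 + T) ^ 2) ^ Fintype.card S :=
          pow_le_pow_right₀ (by nlinarith) ((Finset.card_erase_le).trans (Finset.card_univ (α := S)).le)
      _ = (1 + T) ^ (2 * Fintype.card S) := by rw [← pow_mul]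
  have hkey : c₀ ≤ ((l σ 0 0).re * (l σ 1 1).re - normSq (l σ 0 1)) * (1 + T) ^ (2 * Fintype.card S) := by
    calc c₀ ≤ ∏ τ, ((l τ 0 0).re * (l τ 1 1).re - normSq (l τ 0 1)) := hdet
      _ = (∏ τ ∈ Finset.univ.erase σ, ((l τ 0 0).re * (l τ 1 1).re - normSq (l τ 0 1))) *
            ((l σ 0 0).re * (l σ 1 1).re - normSq (l σ 0 1)) := hsplit.symm
      _ ≤ (1 + T) ^ (2 * Fintype.card S) * ((l σ 0 0).re * (l σ 1 1).re - normSq (l σ 0 1)) :=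
          mul_le_mul_of_nonneg_right hrest hDσ.le
      _ = _ := by ring
  rw [inv_eq_one_div, ← div_eq_inv_mul, div_le_div_iff₀ hDσ hc₀]
  linarith

/-- Exponent bookkeeping: `B^N · (B^{2|S|})^{N′} = B^{N + 2|S|N′}` for `B ≥ 1`. -/
theorem rpow_bookkeeping {B N N' : ℝ} (hB : 1 ≤ B) (n : ℕ) :
    B ^ N * (B ^ (2 * n)) ^ N' = B ^ (N + 2 * n * N') := by
  have hB0 : 0 < B := by linarith
  rw [show (B ^ (2 * n) : ℝ) = B ^ ((2 * n : ℕ) : ℝ) by rw [Real.rpow_natCast], ← Real.rpow_mul hB0.le, ← Real.rpow_add hB0]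
  congr 1
  push_cast
  ring

/-- **THE POINTWISE MAJORANT**: for `g` positive definite, `c₀ > 0`, `N, N′, k ≥ 0` there is `C ≥ 0` such that for every totally positive `l` with
`∏_σ det l_σ ≥ c₀`:  `∏_σ e^{−2π Re tr(l_σ g_σ)} (1 + tr l_σ)^N (1 + det(l_σ)^{−N′}) ≤ C · (1 + ‖l‖)^{−k}`. -/
theorem prod_majorant_le {S : Type*} [Fintype S] {g : S → Matrix (Fin 2) (Fin 2) ℂ} (hg : ∀ σ, (g σ).PosDef) {c₀ : ℝ} (hc₀ : 0 < c₀)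
    {N N' k : ℝ} (hN : 0 ≤ N) (hN' : 0 ≤ N') (hk : 0 ≤ k) :
    ∃ C : ℝ, 0 ≤ C ∧ ∀ l : S → Fin 2 → Fin 2 → ℂ, (∀ σ, (Matrix.of (l σ)).PosDef) →
      c₀ ≤ ∏ σ, ((l σ 0 0).re * (l σ 1 1).re - normSq (l σ 0 1)) →
        ∏ σ, (Real.exp (-(2 * Real.pi * ((Matrix.of (l σ) * g σ).trace).re)) * (1 + ((l σ 0 0).re + (l σ 1 1).re)) ^ N *
          (1 + ((l σ 0 0).re * (l σ 1 1).re - normSq (l σ 0 1)) ^ (-N'))) ≤ C * (1 + ‖l‖) ^ (-k) := by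
  obtain ⟨c, hc, hcle⟩ := exists_trace_mul_lower hg
  set n : ℕ := Fintype.card S with hn
  set Q : ℝ := (N + 2 * n * N') * n with hQ
  have hQ0 : 0 ≤ Q := by positivity
  -- polynomial versus exponential: `(1 + T)^{Q + k} ≤ K e^{2πcT}`
  obtain ⟨K, hK, hKle⟩ := rpow_le_const_mul_exp (lam := 4 * Real.pi * c) (T₀ := 1) (r := Q + k) (by positivity) zero_le_one (by positivity)
  set G₀ : ℝ := 1 + c₀ ^ (-N') with hG₀
  have hG₀1 : 1 ≤ G₀ := by rw [hG₀]; linarith [Real.rpow_nonneg hc₀.le (-N')]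
  refine ⟨G₀ ^ n * K, by positivity, fun l hl hdet => ?_⟩
  set T : ℝ := ∑ τ, ((l τ 0 0).re + (l τ 1 1).re) with hT
  have hT0 : 0 ≤ T := Finset.sum_nonneg fun τ _ => (trace_re_pos (hl τ)).le
  set B : ℝ := 1 + T with hB
  have hB1 : 1 ≤ B := by rw [hB]; linarith
  have hB0 : 0 < B := by linarith
  -- (a) each factor is `≤ e^{−2πc tr l_σ} · B^N · G₀ · (B^{2n})^{N′}`
  have hfac : ∀ σ : S, Real.exp (-(2 * Real.pi * ((Matrix.of (l σ) * g σ).trace).re)) * (1 + ((l σ 0 0).re + (l σ 1 1).re)) ^ N *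
      (1 + ((l σ 0 0).re * (l σ 1 1).re - normSq (l σ 0 1)) ^ (-N')) ≤
      Real.exp (-(2 * Real.pi * c) * ((l σ 0 0).re + (l σ 1 1).re)) * (B ^ N * (G₀ * (B ^ (2 * n)) ^ N')) := by
    intro σ
    have htr := trace_re_pos (hl σ)
    have hD := det_re_pos (hl σ)
    have h1 : Real.exp (-(2 * Real.pi * ((Matrix.of (l σ) * g σ).trace).re)) ≤ Real.exp (-(2 * Real.pi * c) * ((l σ 0 0).re + (l σ 1 1).re)) := by
      refine Real.exp_le_exp.mpr ?_
      have := hcle σ (l σ) (hl σ)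
      nlinarith [Real.pi_pos]
    have h2 : (1 + ((l σ 0 0).re + (l σ 1 1).re)) ^ N ≤ B ^ N := by
      refine Real.rpow_le_rpow (by linarith) ?_ hN
      rw [hB, hT]
      linarith [Finset.single_le_sum (f := fun τ => (l τ 0 0).re + (l τ 1 1).re) (fun τ _ => (trace_re_pos (hl τ)).le) (Finset.mem_univ σ)]
    have h3 : (1 + ((l σ 0 0).re * (l σ 1 1).re - normSq (l σ 0 1)) ^ (-N')) ≤ G₀ * (B ^ (2 * n)) ^ N' := by
      have hinv := inv_det_le l hl hc₀ hdet σ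
      rw [← hT, ← hB] at hinv
      have hpow : ((l σ 0 0).re * (l σ 1 1).re - normSq (l σ 0 1)) ^ (-N') ≤ c₀ ^ (-N') * (B ^ (2 * n)) ^ N' := by
        rw [Real.rpow_neg hD.le, ← Real.inv_rpow hD.le, Real.rpow_neg hc₀.le, ← Real.inv_rpow hc₀.le, ← Real.mul_rpow (inv_nonneg.mpr hc₀.le) (by positivity)]
        exact Real.rpow_le_rpow (inv_nonneg.mpr hD.le) hinv hN'
      have hBN : 1 ≤ (B ^ (2 * n)) ^ N' := Real.one_le_rpow (one_le_pow₀ hB1) hN'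
      have hc0N : 0 ≤ c₀ ^ (-N') := Real.rpow_nonneg hc₀.le _
      rw [hG₀]
      nlinarith
    calc Real.exp (-(2 * Real.pi * ((Matrix.of (l σ) * g σ).trace).re)) * (1 + ((l σ 0 0).re + (l σ 1 1).re)) ^ N *
          (1 + ((l σ 0 0).re * (l σ 1 1).re - normSq (l σ 0 1)) ^ (-N'))
        ≤ Real.exp (-(2 * Real.pi * c) * ((l σ 0 0).re + (l σ 1 1).re)) * B ^ N * (G₀ * (B ^ (2 * n)) ^ N') :=
          mul_le_mul (mul_le_mul h1 h2 (Real.rpow_nonneg (by linarith) _) (Real.exp_pos _).le) h3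
            (by positivity) (mul_nonneg (Real.exp_pos _).le (Real.rpow_nonneg hB0.le _))
      _ = _ := by ring
  -- (b) the product
  have hprod : ∏ σ, (Real.exp (-(2 * Real.pi * ((Matrix.of (l σ) * g σ).trace).re)) * (1 + ((l σ 0 0).re + (l σ 1 1).re)) ^ N *
      (1 + ((l σ 0 0).re * (l σ 1 1).re - normSq (l σ 0 1)) ^ (-N'))) ≤
      Real.exp (-(2 * Real.pi * c) * T) * (B ^ N * (G₀ * (B ^ (2 * n)) ^ N')) ^ n := by
    calc ∏ σ, (Real.exp (-(2 * Real.pi * ((Matrix.of (l σ) * g σ).trace).re)) * (1 + ((l σ 0 0).re + (l σ 1 1).re)) ^ N *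
          (1 + ((l σ 0 0).re * (l σ 1 1).re - normSq (l σ 0 1)) ^ (-N')))
        ≤ ∏ σ, (Real.exp (-(2 * Real.pi * c) * ((l σ 0 0).re + (l σ 1 1).re)) * (B ^ N * (G₀ * (B ^ (2 * n)) ^ N'))) :=
          Finset.prod_le_prod (fun σ _ => mul_nonneg (mul_nonneg (Real.exp_pos _).le (Real.rpow_nonneg (by linarith [trace_re_pos (hl σ)]) _))
            (by linarith [Real.rpow_nonneg (det_re_pos (hl σ)).le (-N')])) fun σ _ => hfac σ
      _ = (∏ σ, Real.exp (-(2 * Real.pi * c) * ((l σ 0 0).re + (l σ 1 1).re))) * ∏ _σ : S, (B ^ N * (G₀ * (B ^ (2 * n)) ^ N')) :=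
          Finset.prod_mul_distrib
      _ = Real.exp (-(2 * Real.pi * c) * T) * (B ^ N * (G₀ * (B ^ (2 * n)) ^ N')) ^ n := by
          rw [Finset.prod_const, Finset.card_univ, ← hn, ← Real.exp_sum, ← Finset.mul_sum]
  -- (c) collect the powers of `B` and trade the polynomial against the exponential
  have hpow : (B ^ N * (G₀ * (B ^ (2 * n)) ^ N')) ^ n = G₀ ^ n * B ^ Q := by
    rw [show B ^ N * (G₀ * (B ^ (2 * n)) ^ N') = G₀ * (B ^ N * (B ^ (2 * n)) ^ N') by ring, rpow_bookkeeping hB1 n, mul_pow,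
      ← Real.rpow_natCast (B ^ (N + 2 * n * N')) n, ← Real.rpow_mul hB0.le, hQ]
  have hexp : Real.exp (-(2 * Real.pi * c) * T) * B ^ (Q + k) ≤ K := by
    have h := hKle (4 * Real.pi * c * T) (by positivity)
    have h4 : 4 * Real.pi * c * T / (4 * Real.pi * c) + 1 = B := by
      rw [hB, mul_div_cancel_left₀ T (by positivity : 4 * Real.pi * c ≠ 0), add_comm]
    rw [h4, show 4 * Real.pi * c * T / 2 = 2 * Real.pi * c * T by ring] at h
    have hE : Real.exp (-(2 * Real.pi * c) * T) * Real.exp (2 * Real.pi * c * T) = 1 := by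
      rw [← Real.exp_add, show -(2 * Real.pi * c) * T + 2 * Real.pi * c * T = 0 by ring, Real.exp_zero]
    calc Real.exp (-(2 * Real.pi * c) * T) * B ^ (Q + k) ≤ Real.exp (-(2 * Real.pi * c) * T) * (K * Real.exp (2 * Real.pi * c * T)) :=
          mul_le_mul_of_nonneg_left h (Real.exp_pos _).le
      _ = K := by rw [mul_comm K, ← mul_assoc, hE, one_mul]
  have hBk : B ^ (-k) ≤ (1 + ‖l‖) ^ (-k) := by
    have hl0 : 0 < 1 + ‖l‖ := by positivity
    have hle : 1 + ‖l‖ ≤ B := by rw [hB]; linarith [norm_le_sum_trace l hl]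
    exact Real.rpow_le_rpow_of_nonpos hl0 hle (by linarith)
  calc ∏ σ, (Real.exp (-(2 * Real.pi * ((Matrix.of (l σ) * g σ).trace).re)) * (1 + ((l σ 0 0).re + (l σ 1 1).re)) ^ N *
        (1 + ((l σ 0 0).re * (l σ 1 1).re - normSq (l σ 0 1)) ^ (-N')))
      ≤ Real.exp (-(2 * Real.pi * c) * T) * (B ^ N * (G₀ * (B ^ (2 * n)) ^ N')) ^ n := hprod
    _ = G₀ ^ n * (Real.exp (-(2 * Real.pi * c) * T) * B ^ (Q + k)) * B ^ (-k) := by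
        have hsplit : B ^ (Q + k) * B ^ (-k) = B ^ Q := by rw [← Real.rpow_add hB0, show Q + k + -k = Q by ring]
        rw [hpow, ← hsplit]
        ring
    _ ≤ G₀ ^ n * K * (1 + ‖l‖) ^ (-k) := by
        have hG : 0 ≤ G₀ ^ n := by positivity
        calc G₀ ^ n * (Real.exp (-(2 * Real.pi * c) * T) * B ^ (Q + k)) * B ^ (-k) ≤ G₀ ^ n * K * B ^ (-k) := by
              rw [mul_assoc (G₀ ^ n) K]
              exact mul_le_mul_of_nonneg_right (mul_le_mul_of_nonneg_left hexp hG) (Real.rpow_nonneg hB0.le _) |>.trans (le_of_eq (by ring))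
          _ ≤ G₀ ^ n * K * (1 + ‖l‖) ^ (-k) := mul_le_mul_of_nonneg_left hBk (by positivity)

/-! ## The head: summability over the totally positive lattice points -/

/-- `Σ_{l ∈ Λ} (1 + ‖l‖)^{−k} < ∞` for a discrete `ℤ`-submodule `Λ` of a finite-dimensional real normed space and `k > rank Λ`
(Mathlib ★ `ZLattice.summable_norm_rpow`, comparing off `0`). -/
theorem summable_one_add_norm_rpow_neg {V : Type*} [NormedAddCommGroup V] [NormedSpace ℝ V] [FiniteDimensional ℝ V]
    (Λ : Submodule ℤ V) [DiscreteTopology Λ] {k : ℝ} (hk : (Module.finrank ℤ Λ : ℝ) < k) :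
    Summable fun z : Λ => (1 + ‖z‖) ^ (-k) := by
  have h := ZLattice.summable_norm_rpow Λ (-k) (by linarith)
  refine Summable.of_norm_bounded_eventually h ?_
  refine Filter.eventually_cofinite.mpr ((Set.finite_singleton (0 : Λ)).subset fun z hz => ?_)
  rw [Set.mem_singleton_iff]
  by_contra hne
  apply hz
  have hz0 : 0 < ‖z‖ := norm_pos_iff.mpr hne
  rw [Real.norm_of_nonneg (Real.rpow_nonneg (by positivity) _)]
  exact Real.rpow_le_rpow_of_nonpos hz0 (by linarith) (by linarith [show (0 : ℝ) ≤ Module.finrank ℤ Λ from Nat.cast_nonneg _])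

/-- **THE LATTICE COUNT** (head (H2) of Φ6b-5).  `S` finite, `g : S → Matrix (Fin 2) (Fin 2) ℂ` positive definite, `Λ` a discrete
`ℤ`-submodule of `S → (Fin 2 → Fin 2 → ℂ)`, `hdet : ∃ c > 0, ∀ l ∈ Λ, (∀ σ, l_σ > 0) → c ≤ ∏_σ det l_σ`; then for all real `N, N′ ≥ 0`
the three-factor majorant is summable over the totally positive points of `Λ`:
`Summable (fun i => ∏_σ e^{−2π Re tr(l_σ g_σ)} (1 + tr l_σ)^N (1 + det(l_σ)^{−N′}))`. -/
theorem summable_lattice_prod_majorant {S : Type*} [Fintype S] {g : S → Matrix (Fin 2) (Fin 2) ℂ} (hg : ∀ σ, (g σ).PosDef)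
    (Λ : Submodule ℤ (S → Fin 2 → Fin 2 → ℂ)) [DiscreteTopology Λ]
    (hdet : ∃ c : ℝ, 0 < c ∧ ∀ l ∈ Λ, (∀ σ, (Matrix.of (l σ)).PosDef) → c ≤ ∏ σ, ((l σ 0 0).re * (l σ 1 1).re - normSq (l σ 0 1)))
    {N N' : ℝ} (hN : 0 ≤ N) (hN' : 0 ≤ N') :
    Summable fun i : {l : Λ // ∀ σ, (Matrix.of ((l : S → Fin 2 → Fin 2 → ℂ) σ)).PosDef} =>
      ∏ σ, (Real.exp (-(2 * Real.pi * ((Matrix.of ((i.1 : S → Fin 2 → Fin 2 → ℂ) σ) * g σ).trace).re)) *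
        (1 + (((i.1 : S → Fin 2 → Fin 2 → ℂ) σ 0 0).re + ((i.1 : S → Fin 2 → Fin 2 → ℂ) σ 1 1).re)) ^ N *
        (1 + (((i.1 : S → Fin 2 → Fin 2 → ℂ) σ 0 0).re * ((i.1 : S → Fin 2 → Fin 2 → ℂ) σ 1 1).re -
          normSq ((i.1 : S → Fin 2 → Fin 2 → ℂ) σ 0 1)) ^ (-N'))) := by
  obtain ⟨c₀, hc₀, hdet⟩ := hdet
  set k : ℝ := (Module.finrank ℤ Λ : ℝ) + 1 with hk
  have hk0 : 0 ≤ k := by positivity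
  obtain ⟨C, hC, hle⟩ := prod_majorant_le hg hc₀ hN hN' hk0
  have hbase : Summable fun z : Λ => C * (1 + ‖z‖) ^ (-k) := (summable_one_add_norm_rpow_neg Λ (by linarith)).mul_left C
  have hsub := hbase.subtype {l : Λ | ∀ σ, (Matrix.of ((l : S → Fin 2 → Fin 2 → ℂ) σ)).PosDef}
  refine Summable.of_nonneg_of_le (fun i => ?_) (fun i => ?_) hsub
  · exact Finset.prod_nonneg fun σ _ => mul_nonneg (mul_nonneg (Real.exp_pos _).le (Real.rpow_nonneg (by linarith [trace_re_pos (i.2 σ)]) _))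
      (by linarith [Real.rpow_nonneg (det_re_pos (i.2 σ)).le (-N')])
  · have h := hle (i.1 : S → Fin 2 → Fin 2 → ℂ) i.2 (hdet _ i.1.2 i.2)
    simpa only [Function.comp_apply, Submodule.coe_norm] using h

end Summit.HodgeConjecture.HodgeConjecture.Cruxes.HLiu418.K2LiuHermTwoLatticeProdMajorant

end
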